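import Summits.ResolutionOfSingularities.ResolutionOfSingularities.Theorems.FrobeniusLadderFInjectiveMacaulayficationLocalFullificationFibreGe4
import HarnessLib

/-!
# (LF_cl) `LocalFullificationFibreClosedGe4` — (LF) restricted to CLOSED points: the weakest local FULL-ification statement the LOCAL DOOR consumes
# (crux `FInjectiveMacaulayfication` stmt-ResolutionOfSingularities-15315, chain w45a; res-L1-w45a-plan-1 RULING R17.6 (2) «refinements ride as v36.1 by
# one-name rebinds»; seat res-L1-w45a-stub-2 g6)

[OURS · L1 W4.5a] STATEMENT file (`--supports stmt-ResolutionOfSingularities-15315 --as helper`); ONE `Prop`-valued CANDIDATE statement of OURS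
(`@[conjecture] def`, consumed only as a hypothesis; no instance, no notation, no named fact) and its comparison with (LF); replaces the role of NO
printed item; NOT a statement of the manuscript; AI-written (AI review is weaker than expert review).

WHAT. (LF_cl) = (LF) `LocalFullificationFibreGe4.LocalFullificationFibreGe4` (p587725) with the SINGLE insertion `IsClosed ({x} : Set X) →` before the
binder `ringKrullDim (X.presheaf.stalk x) = d →` — nothing else touched. In words: for every `d ≥ 4`, every integral variety `X/k` (`char k = p`),
every CLOSED point `x` of local dimension `d` (so `dim X = d`), and every blowing up `g : S′ → Spec 𝒪_{X,x}` along `I ≠ ⊥` that is regular off its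
closed fibre, there is a fibre-supported centre `𝓚 ≠ ⊥` on `S′` all of whose blowings up are FULL at every point.
* `localFullificationFibreClosedGe4_of_ge4 : LocalFullificationFibreGe4 → LocalFullificationFibreClosedGe4` (drop the closedness hypothesis).

WHY IT SUFFICES (plan-1 R17.6 (2); checked on the tree text by this seat). The F-Temkin induction (`FTemkinClosedPointsGen.full_model_of_regularOffFinite_of_LF`,
p587868) invokes (LF) ONLY at the points `b` of the finite residual set `F`, which are CLOSED (`hFcl`) — the companion file `…FTemkinClosedPointsLocal`
re-runs it from a per-`X` hypothesis at closed singular points and derives the (LF_cl) versions. So door v36.1 may register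
`stub_localFullificationFibreClosedGe4` in place of `stub_localFullificationFibreGe4` (weaker-or-equal registered residue). The non-closed points of
local dimension `≥ 4` are (LR)'s business (local RESOLUTION), not (LF)'s.
JUNK CHECKS: as for (LF)/(L4♭) — `I ≠ ⊥` excludes `S′ = ∅`; `S′` regular ⇒ `𝓚 := ⊤`; a closed point of local dimension `d` forces `dim X = d`
(closed points of a `k`-variety have local dimension `dim X`), so (LF_cl)(d) speaks exactly about the closed points of `d`-folds. ≤ S_loc(d) as (LF).
[candidate statement, OURS; cite: Temkin2008, Prop. 2.3.4 and Lemma 2.1.1 (shape)]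
-/

-- single-problem summit: the doubled namespace component is forced
set_option linter.dupNamespace false

noncomputable section

open AlgebraicGeometry CategoryTheory Literature.AlgebraicGeometry.Resolution TopologicalSpace IsLocalRing

namespace Summit.ResolutionOfSingularities.ResolutionOfSingularities.Theorems.FInjectiveMacaulayfication.LocalFullificationFibreClosedGe4

open Summit.ResolutionOfSingularities.ResolutionOfSingularities.Theorems.FInjectiveMacaulayfication

/-- [OURS · CANDIDATE statement, not a fact] **(LF_cl) LOCAL FULL-IFICATION AT CLOSED POINTS OF LOCAL DIMENSION `d ≥ 4`, FIBRE-SUPPORTED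
CENTRE.** For every `d ≥ 4`: for a prime `p`, a field `k` of characteristic `p`, an integral separated `k`-scheme `X` of finite type, a CLOSED point
`x ∈ X` with `dim 𝒪_{X,x} = d`, and a blowing up `g : S′ → Spec 𝒪_{X,x}` along an ideal sheaf `I ≠ ⊥` such that `S′` is REGULAR at every point off
the closed fibre `g⁻¹(x)`: there is an ideal sheaf `𝓚 ≠ ⊥` on `S′`, supported in the closed fibre, such that EVERY blowing up `S″ → S′` along `𝓚` is
FULL at EVERY point (`SliceableCentre.FullCl`). = (LF) `LocalFullificationFibreGe4` restricted to closed `x`. [candidate statement, OURS; open for every `d ≥ 4`] -/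
@[conjecture] def LocalFullificationFibreClosedGe4 : Prop :=
  ∀ d : ℕ, 4 ≤ d →
  ∀ (p : ℕ), p.Prime → ∀ (k : Type) [Field k] [CharP k p]
    (X : Scheme.{0}) (f : X ⟶ Spec (.of k)),
      IsSeparated f → LocallyOfFiniteType f → QuasiCompact f → IsIntegral X →
      ∀ x : X, IsClosed ({x} : Set X) → ringKrullDim (X.presheaf.stalk x) = d →
      ∀ (S' : Scheme.{0}) (g : S' ⟶ Spec (X.presheaf.stalk x)) (I : (Spec (X.presheaf.stalk x)).IdealSheafData),
        I ≠ ⊥ → IsBlowup g I →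
        (∀ s : S', g.base s ≠ closedPoint (X.presheaf.stalk x) → s ∈ Scheme.regularLocus S') →
        ∃ 𝓚 : S'.IdealSheafData, 𝓚 ≠ ⊥ ∧ (∀ s ∈ (𝓚.support : Set S'), g.base s = closedPoint (X.presheaf.stalk x)) ∧
          ∀ (S'' : Scheme.{0}) (π : S'' ⟶ S'), IsBlowup π 𝓚 →
            ∀ s : S'', SliceableCentre.FullCl p (S''.presheaf.stalk s)

/-- **(LF) ⇒ (LF_cl)**: drop the closedness hypothesis. [folklore] -/
theorem localFullificationFibreClosedGe4_of_ge4 (h : LocalFullificationFibreGe4.LocalFullificationFibreGe4) :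
    LocalFullificationFibreClosedGe4 :=
  fun d hd p hp k _ _ X f hsep hft hqc hint x _ hx => h d hd p hp k X f hsep hft hqc hint x hx

end Summit.ResolutionOfSingularities.ResolutionOfSingularities.Theorems.FInjectiveMacaulayfication.LocalFullificationFibreClosedGe4

end
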